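import Literature.MathematicalPhysics.QuantumFieldTheory.Balaban1983to89.B5G0DiagTorus
import Literature.MathematicalPhysics.QuantumFieldTheory.Balaban1983to89.B5Prop11G0Tower

/-!
# `Balaban1983to89.B5Prop12G0DiagTorus` — «… and we have Proposition 1.1 for G₀.» (p. 39 L29) for the DIAGONAL G₀-setting,
# its model signs and cube facts, and the capstones: PROPOSITION 1.2 FOR G₀ ON THE TORUS FROM «(1.114) FOR G₀» ALONE

statement-level skeleton of published theorems with citation tags; proofs where landed; nothing here is a claim
about the Yang–Mills mass gap

Source (lit-balaban / pub-balaban cells): T. Bałaban, *Propagators and renormalization transformations for lattice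
gauge theories. I*, Commun. Math. Phys. **95** (1984) 17–40 [`Balaban1984PropagatorsI`, "B5"], p. 33 [PDF 17] (Prop. 1.1
(1.89)–(1.90)), pp. 35–36 [PDF 19–20] (Prop. 1.2 (1.108)–(1.114)), p. 39 [PDF 23] ((1.132)–(1.134)); held as
`paper:balaban1984-cmp95-propagators-rt-i`.

## WHAT IS PRINTED (verbatim, p. 39 [PDF 23]; docstring v1.1 — the located sentences, per the second reader r05 pass 12;
## docstring v1.2 — r05 pass 27 (a) / pass 15-(b): the retired paraphrase «… holds for G₀ also» that survived in guillemets in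
## the title, the §2 heading and two cite tags is replaced by the printed words of p. 39 L29 «… and we have Proposition 1.1
## for G₀.»; declarations byte-identical)

«This operator is given by the formula G₀J = Δ⁻¹J − aΔ⁻¹Q*𝒟⁻¹QΔ⁻¹J (1.134) for J orthogonal to constant functions, and
G₀J = a⁻¹J for J constant, hence by the first two terms in the representation (1.81). Thus its momentum representation is
given by (1.87) and we have Proposition 1.1 for G₀. This leads also to (1.114) by the same reasoning with a random walk
expansion as for G.»  NOT PRINTED, this module's derivation: the operator inequality `Δ + aQ*Q ≥ a(−4dΔ + aI)⁻¹(−Δ + I)` by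
which §2 obtains Proposition 1.1 for G₀ from r02's tower bounds (the v1.0 header presented it inside the quotation; corrected
here, content of the module unchanged).

## WHAT THIS MODULE PROVES (kernel-checked, zero sorry)

For the diagonal G₀-setting `B5G0DiagTorus.g0Diag P a m² k` (G₀ = ⊕_μ G₀^{(μ)} on 1-forms, sources of the three kinds):
§1 `modelSigns_g0Diag`, `cubeFacts_g0Diag` (the sign and cube facts the (1.132)-transfer `B5Transfer132.prop12_of_G0_via132`
   asks of the G₀ side);
§2 **`prop11_g0Diag`**, **`prop11_famDiagTop : B5.Prop11Printed (famDiagTop d L a 0)`** (m² = 0, k = K, one constant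
   γ₀(G₀) = `B5Prop11G0Torus.gammaG0 d a`): all six norms of (1.89) and the form inequality (1.90) for the diagonal setting
   ARE r02's tower bounds `B5G0BridgeP12.towerG0_ineq189_0 … _5`, `towerG0_ineq190` (transport of the matrix-side
   `B5Prop11G0Torus`), the η^{d/2} weights cancelling (`B5Prop11G0Tower.l2Fam_le_of_sq`);
§3 THE CAPSTONES, with «Proposition 1.1 for G₀» DISCHARGED by r02's `B5Prop11G0Tower.prop11Printed_famG0Top`:
   **`prop12G0Top_of_local114 (h114G0 : Local114Fam (famG0Top d L a 0)) : Prop12Printed (famG0Top d L a 0)`** (the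
   per-direction scalar family of record) and **`prop12DiagTop_of_local114 (h114 : Local114Fam (famDiagTop d L a 0)) :
   Prop12Printed (famDiagTop d L a 0)`** (the diagonal family of record) — PROPOSITION 1.2 FOR BAŁABAN'S G₀ ON THE TORUS
   FROM THE ONE PRINTED SENTENCE «This leads also to (1.114) …» ALONE (the random-walk step (1.118)–(1.131), cell census (vi)).
§4 `Local114SixthFam` (the sixth member of (1.114) alone), **`local114_diag_of_scalar`** / `local114DiagTop_of_scalar`:
   (1.114) for the diagonal family from (1.114) for the scalar members + the sixth member (single-component and row
   sources; constant (d + 1)·max C), and `prop12DiagTop_of_scalar114`.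
HONEST SCOPE: m² = 0 (B5's G₀ = (Δ + aQ*Q)⁻¹ has no mass), a > 0, U = 1, tori of `Setup` with P.d = d, P.L = L, K ≥ 1;
the scalar family carries DIVERGENCE T of `B5G0SettingTorus` (h1 := 0 for α > 1, GAPS G-B5-02), irrelevant to Prop. 1.2's
range 0 ≤ α < 1.  CELL BOOK-KEEPING: rows B5.Prop1.2 census (iv) + (vii), B5.Eq1.134 (owner r02, referee ref-4); VALUE =
bookkeeping closure of the G₀ block, NOT summit progress.
-/

namespace Literature.MathematicalPhysics.QuantumFieldTheory.Balaban1983to89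

open Matrix

noncomputable section

namespace B5Prop12G0DiagTorus

open B1RG242Torus B5Ineq137Torus B5GpSettingTorus B5Eq133G0Torus B5G0SettingTorus B5FromB4 B5G0DiagTorus B5TowerSourcesG0
open B5G0BridgeP12 (tl2 tl2T tG0 tD tDiv tDiv2 towerG0_ineq189_0 towerG0_ineq189_1 towerG0_ineq189_2 towerG0_ineq189_3
  towerG0_ineq189_4 towerG0_ineq189_5 towerG0_ineq190 gammaG0_pos')
open B5Prop11G0Tower (l2Fam_le_of_sq dEta_mul_mulVec opDiv_eq opDD_eq prop11Printed_famG0Top)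
open B5Prop11G0Torus (gammaG0)

variable {P : Params}

/-! ## §1 Model signs and cube facts of the diagonal setting -/

/-- **The model signs of `g0Diag`** (distances, norms and cut-off factors are non-negative).
[cite: Balaban1984PropagatorsI, (1.108)–(1.109) p.35] -/
theorem modelSigns_g0Diag (a msq : ℝ) (k : ℕ) : B5FromB4.ModelSigns (g0Diag P a msq k) where
  dist_nonneg := fun y y' => T_nonneg P k y y'
  supNorm_nonneg := fun J => supNormT_nonneg P J
  l2Norm_nonneg := fun J => l2NormT_nonneg P k J
  holder_nonneg := fun ε J => holder3_nonneg k ε J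
  cutH_nonneg := fun α ζ => cutHV_nonneg k α ζ
  cutSup_nonneg := fun ζ => supN_nonneg P ζ

/-- **The two cube facts of p. 35 for `g0Diag`, c = 2** (its sites ARE T₁^{(k)} with the sup torus distance).
[cite: Balaban1984PropagatorsI, p.35 (the cubes Δ̃(y))] -/
theorem cubeFacts_g0Diag (a msq : ℝ) {k : ℕ} (hk : k ≤ P.m + P.K) :
    CubeFacts P (g0Diag P a msq k) (inCube P k) 2 :=
  cubeFacts_model (S := g0Diag P a msq k) hk id (fun _ _ => rfl)

/-! ## §2 «… and we have Proposition 1.1 for G₀.» (p. 39 L29) for the diagonal setting (m² = 0, k = K) -/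

/-- √X ≤ c√Y ⇒ X ≤ c²Y (X, Y ≥ 0). [folklore] -/
private theorem sq_le_of_sqrt_le' {X Y c : ℝ} (hX : 0 ≤ X) (hY : 0 ≤ Y) (h : Real.sqrt X ≤ c * Real.sqrt Y) :
    X ≤ c ^ 2 * Y := by
  have h2 : Real.sqrt X ^ 2 ≤ (c * Real.sqrt Y) ^ 2 := pow_le_pow_left₀ (Real.sqrt_nonneg _) h 2
  rwa [Real.sq_sqrt hX, mul_pow, Real.sq_sqrt hY] at h2

/-- Double sums of squares are non-negative. [folklore] -/
private theorem sum2_nonneg {ι κ : Type} [Fintype ι] [Fintype κ] (F : ι → κ → ℝ) : 0 ≤ ∑ i, ∑ x, F i x ^ 2 :=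
  Finset.sum_nonneg fun _ _ => Finset.sum_nonneg fun _ _ => sq_nonneg _

/-- `−Δ^η + 1` at the top level is `hOp P 0 ε 1`. [cite: Balaban1984PropagatorsI, Prop. 1.1 (1.90) p.33] -/
theorem lapEta_top_add_one : lapEta P P.K + 1 = hOp P 0 P.eps 1 := by
  rw [lapEta_top, H, hOp, hOp, zero_smul, zero_add, one_smul, add_comm]

section Top

variable (P) {a : ℝ}

/-- **(G₀A)_μ in the tower typing**: the diagonal kernel `dK0` at (m² = 0, k = K) is r02's `tG0`.
[cite: Balaban1984PropagatorsI, (1.132) p.39] -/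
theorem dK0_top (A : Fin P.d → Site P 0 → ℝ) : (fun μ x => (1 : ℝ) * dK0 P a 0 P.K A μ x) = tG0 P a A := by
  funext μ x; simp [dK0, opK0, tG0]

/-- **(∇G₀A)_{λμ} in the tower typing.** [cite: Balaban1984PropagatorsI, (1.89) p.33] -/
theorem dKD_top (A : Fin P.d → Site P 0 → ℝ) (p : Fin P.d × Fin P.d) (x : Site P 0) :
    (1 : ℝ) * dKD P a 0 P.K A p x = tD P p.1 (tG0 P a A) p.2 x := by
  rw [one_mul, dKD, opKD, dEta_mul_mulVec]
  rfl

/-- **(∇∇G₀A)_{(λλ′)μ} in the tower typing.** [cite: Balaban1984PropagatorsI, (1.89) p.33] -/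
theorem dKD2_top (A : Fin P.d → Site P 0 → ℝ) (p : (Fin P.d × Fin P.d) × Fin P.d) (x : Site P 0) :
    (1 : ℝ) * dKD2 P a 0 P.K A p x = tD P p.1.1 (tD P p.1.2 (tG0 P a A)) p.2 x := by
  rw [one_mul, dKD2, opKD2, Matrix.mul_assoc, ← Matrix.mulVec_mulVec, dEta_top, dEta_mul_mulVec]
  rfl

/-- **(G₀∇*T)_μ in the tower typing.** [cite: Balaban1984PropagatorsI, (1.89) p.33] -/
theorem dDiv_top (T : Fin P.d → Fin P.d → Site P 0 → ℝ) (μ : Fin P.d) (x : Site P 0) :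
    (1 : ℝ) * dDiv P a 0 P.K T μ x = tG0 P a (tDiv P T) μ x := by
  rw [one_mul, dDiv, opDiv_eq]
  simp only [tG0, tDiv, Finset.sum_apply, B5G0DiagTorus.row]

/-- **(∇G₀∇*T)_{λμ} in the tower typing.** [cite: Balaban1984PropagatorsI, (1.89) p.33] -/
theorem dDD_top (T : Fin P.d → Fin P.d → Site P 0 → ℝ) (p : Fin P.d × Fin P.d) (x : Site P 0) :
    (1 : ℝ) * dDD P a 0 P.K T p x = tD P p.1 (tG0 P a (tDiv P T)) p.2 x := by
  rw [one_mul, dDD, opDD_eq]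
  simp only [tD, tG0, tDiv, Finset.sum_apply, B5G0DiagTorus.row]

/-- **(G₀∇*∇*T)_μ in the tower typing.** [cite: Balaban1984PropagatorsI, (1.89) p.33] -/
theorem dDiv2_top (T : Fin P.d × Fin P.d → Fin P.d → Site P 0 → ℝ) (μ : Fin P.d) (x : Site P 0) :
    (1 : ℝ) * dDiv2 P a 0 P.K T μ x = tG0 P a (tDiv2 P T) μ x := by
  rw [one_mul, dDiv2]
  simp only [tG0, tDiv2, Finset.sum_apply, dEta_top]

end Top

section Prop11

variable (P) {a : ℝ} (ha : 0 < a)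
include ha

/-- **«… and we have Proposition 1.1 for G₀.» (p. 39 L29) for the diagonal setting of one torus** (m² = 0, k = K): the six
norms (1.89) and the form inequality (1.90) with γ₀ = `gammaG0 P.d a`. [cite: Balaban1984PropagatorsI, Prop. 1.1 (1.89)–(1.90) p.33, p.39] -/
theorem prop11_g0Diag :
    (∀ (n : Fin 6) (J : (g0Diag P a 0 P.K).Loc),
        (g0Diag P a 0 P.K).l2op n J ≤ (gammaG0 P.d a)⁻¹ * (g0Diag P a 0 P.K).l2Norm J) ∧
      (∀ A : (g0Diag P a 0 P.K).Vec,
        gammaG0 P.d a * (g0Diag P a 0 P.K).formΔI A ≤ (g0Diag P a 0 P.K).formΔa A) := by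
  have hγ : 0 ≤ (gammaG0 P.d a)⁻¹ := inv_nonneg.mpr (gammaG0_pos' ha.le).le
  refine ⟨?_, ?_⟩
  · intro n J
    change LocT P at J
    cases J with
    | vec A =>
      have hn : 0 ≤ (gammaG0 P.d a)⁻¹ * l2Fam P P.K A := mul_nonneg hγ (l2Fam_nonneg (P := P) P.K A)
      fin_cases n
      · -- ‖G₀A‖
        show l2Fam P P.K (fun μ x => (1 : ℝ) * dK0 P a 0 P.K A μ x) ≤ (gammaG0 P.d a)⁻¹ * l2Fam P P.K A
        rw [dK0_top P]
        refine l2Fam_le_of_sq P P.K _ _ hγ ?_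
        have h := towerG0_ineq189_0 P ha A
        unfold tl2 at h
        exact sq_le_of_sqrt_le' (sum2_nonneg _) (sum2_nonneg _) h
      · -- ‖∇G₀A‖
        show l2Fam P P.K (fun (p : Fin P.d × Fin P.d) x => (1 : ℝ) * dKD P a 0 P.K A p x) ≤
          (gammaG0 P.d a)⁻¹ * l2Fam P P.K A
        refine l2Fam_le_of_sq P P.K _ _ hγ ?_
        have h := towerG0_ineq189_1 P ha A
        unfold tl2 tl2T at h
        have h2 := sq_le_of_sqrt_le' (Finset.sum_nonneg fun _ _ => sum2_nonneg _) (sum2_nonneg _) h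
        refine le_trans (le_of_eq ?_) h2
        rw [Fintype.sum_prod_type]
        simp only [dKD_top P]
      · exact hn
      · exact hn
      · -- ‖∇∇G₀A‖
        show l2Fam P P.K (fun (p : (Fin P.d × Fin P.d) × Fin P.d) x => (1 : ℝ) * dKD2 P a 0 P.K A p x) ≤
          (gammaG0 P.d a)⁻¹ * l2Fam P P.K A
        refine l2Fam_le_of_sq P P.K _ _ hγ ?_
        have h := towerG0_ineq189_4 P ha A
        unfold tl2 tl2T at h
        have h2 := sq_le_of_sqrt_le' (Finset.sum_nonneg fun _ _ => sum2_nonneg _) (sum2_nonneg _) h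
        refine le_trans (le_of_eq ?_) h2
        rw [Fintype.sum_prod_type]
        simp only [dKD2_top P]
      · exact hn
    | ten T =>
      have hn : 0 ≤ (gammaG0 P.d a)⁻¹ * l2Fam P P.K (fun p : Fin P.d × Fin P.d => T p.1 p.2) :=
        mul_nonneg hγ (l2Fam_nonneg (P := P) P.K _)
      have hT : ∑ p : Fin P.d × Fin P.d, ∑ x, T p.1 p.2 x ^ 2 = ∑ ν, ∑ μ, ∑ x, T ν μ x ^ 2 := by
        rw [Fintype.sum_prod_type]
      fin_cases n
      · exact hn
      · exact hn
      · -- ‖G₀∇*T‖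
        show l2Fam P P.K (fun μ x => (1 : ℝ) * dDiv P a 0 P.K T μ x) ≤
          (gammaG0 P.d a)⁻¹ * l2Fam P P.K (fun p : Fin P.d × Fin P.d => T p.1 p.2)
        refine l2Fam_le_of_sq P P.K _ _ hγ ?_
        have h := towerG0_ineq189_2 P ha T
        unfold tl2 tl2T at h
        have h2 := sq_le_of_sqrt_le' (sum2_nonneg _) (Finset.sum_nonneg fun _ _ => sum2_nonneg _) h
        rw [hT]
        refine le_trans (le_of_eq ?_) h2
        simp only [dDiv_top P]
      · -- ‖∇G₀∇*T‖
        show l2Fam P P.K (fun (p : Fin P.d × Fin P.d) x => (1 : ℝ) * dDD P a 0 P.K T p x) ≤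
          (gammaG0 P.d a)⁻¹ * l2Fam P P.K (fun p : Fin P.d × Fin P.d => T p.1 p.2)
        refine l2Fam_le_of_sq P P.K _ _ hγ ?_
        have h := towerG0_ineq189_3 P ha T
        unfold tl2T at h
        have h2 := sq_le_of_sqrt_le' (Finset.sum_nonneg fun _ _ => sum2_nonneg _)
          (Finset.sum_nonneg fun _ _ => sum2_nonneg _) h
        rw [hT]
        refine le_trans (le_of_eq ?_) h2
        rw [Fintype.sum_prod_type]
        simp only [dDD_top P]
      · exact hn
      · exact hn
    | ten2 T =>
      have hn : 0 ≤ (gammaG0 P.d a)⁻¹ * l2Fam P P.K (fun p : (Fin P.d × Fin P.d) × Fin P.d => T p.1 p.2) :=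
        mul_nonneg hγ (l2Fam_nonneg (P := P) P.K _)
      fin_cases n
      · exact hn
      · exact hn
      · exact hn
      · exact hn
      · exact hn
      · -- ‖G₀∇*∇*T‖
        show l2Fam P P.K (fun μ x => (1 : ℝ) * dDiv2 P a 0 P.K T μ x) ≤
          (gammaG0 P.d a)⁻¹ * l2Fam P P.K (fun p : (Fin P.d × Fin P.d) × Fin P.d => T p.1 p.2)
        refine l2Fam_le_of_sq P P.K _ _ hγ ?_
        have h := towerG0_ineq189_5 P ha T
        unfold tl2 tl2T at h
        have h2 := sq_le_of_sqrt_le' (sum2_nonneg _) (Finset.sum_nonneg fun _ _ => sum2_nonneg _) h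
        have hT : ∑ p : (Fin P.d × Fin P.d) × Fin P.d, ∑ x, T p.1 p.2 x ^ 2 =
            ∑ q : Fin P.d × Fin P.d, ∑ μ, ∑ x, T q μ x ^ 2 := by
          rw [Fintype.sum_prod_type]
        rw [hT]
        refine le_trans (le_of_eq ?_) h2
        simp only [dDiv2_top P]
  · -- (1.90)
    intro A
    change Fin P.d → Site P 0 → ℝ at A
    show gammaG0 P.d a * ∑ μ, formOp P P.K (lapEta P P.K + 1) (A μ) ≤ ∑ μ, formOp P P.K (M0 P a 0 P.K μ) (A μ)
    simp only [formOp, lapEta_top_add_one]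
    rw [← Finset.mul_sum, ← Finset.mul_sum, mul_left_comm]
    exact mul_le_mul_of_nonneg_left (towerG0_ineq190 P ha A) (by positivity)

end Prop11

/-- **«… AND WE HAVE PROPOSITION 1.1 FOR G₀.» (p. 39 L29) FOR THE DIAGONAL FAMILY OF RECORD**: `B5.Prop11Printed
(famDiagTop d L a 0)`, one constant γ₀ = `gammaG0 d a` for all tori of dimension d. [cite: Balaban1984PropagatorsI, Prop. 1.1 p.33, p.39 L29 («… and we have Proposition 1.1 for G₀.»)] -/
theorem prop11_famDiagTop (d L : ℕ) {a : ℝ} (ha : 0 < a) : B5.Prop11Printed (famDiagTop d L a 0) := by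
  refine ⟨gammaG0 d a, gammaG0_pos' ha.le, fun i => ?_⟩
  obtain ⟨P, hPd, hPL, hK⟩ := i
  subst hPd
  exact prop11_g0Diag P ha

/-! ## §3 The capstones: Proposition 1.2 for G₀ on the torus from «(1.114) for G₀» alone -/

section Capstone

variable (d L : ℕ) (hd : 1 ≤ d) (hL : Odd L ∧ 1 < L) {a : ℝ} (ha : 0 < a)
include hd hL ha

/-- **PROPOSITION 1.2 FOR THE SCALAR G₀-FAMILY OF RECORD FROM «(1.114) FOR G₀» ALONE** (m² = 0): (1.110)–(1.113) for G′
are theorems (`B5Prop12GpTorus`), the (1.133)-transfer is a theorem (`B5Display133G0Torus`), «Proposition 1.1 for G₀»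
is a theorem (`B5Prop11G0Tower.prop11Printed_famG0Top`); the one remaining printed input is «This leads also to (1.114)».
[cite: Balaban1984PropagatorsI, Prop. 1.2 (1.110)–(1.114) pp.35–36, (1.132)–(1.134) p.39] -/
theorem prop12G0Top_of_local114 (h114G0 : B5.Local114Fam (famG0Top d L a 0)) : B5.Prop12Printed (famG0Top d L a 0) :=
  B5Display133G0Torus.prop12G0_torus_top d L hd hL ha le_rfl (prop11Printed_famG0Top d L ha) (fun _ => h114G0)

/-- **PROPOSITION 1.2 FOR THE DIAGONAL G₀ = (Δ + aQ*Q)⁻¹ ON 1-FORMS OF EVERY TORUS FROM «(1.114) FOR G₀» ALONE** (m² = 0):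
the input of r02's (1.132)-transfer `B5Transfer132.prop12_of_G0_via132` on the G₀ side, modulo the random-walk step
(1.118)–(1.131) for the diagonal family. [cite: Balaban1984PropagatorsI, Prop. 1.2 (1.110)–(1.114) pp.35–36, (1.132)–(1.134) p.39] -/
theorem prop12DiagTop_of_local114 (h114 : B5.Local114Fam (famDiagTop d L a 0)) : B5.Prop12Printed (famDiagTop d L a 0) :=
  prop12Diag_top d L hd hL ha le_rfl (prop11Printed_famG0Top d L ha) h114

end Capstone

/-! ## §4 (1.114) for the diagonal family from (1.114) for the scalar members and the sixth member alone -/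

section Sixth

variable {I : Type} (Pf : I → Params) (a msq : ℝ)

/-- **The sixth member of (1.114) alone** for a family: ‖ζG∇*∇*J‖ ≤ O(1)e^{−δ₀|y−y′|}|ζ|‖J‖ (the member that the per-direction
scalar settings leave vacuous). [cite: Balaban1984PropagatorsI, (1.114) p.36] -/
def Local114SixthFam {I' : Type} (fam : I' → B5.Setting) : Prop :=
  ∃ δ₀ C : ℝ, 0 < δ₀ ∧ 0 < C ∧ ∀ i, ∀ (J : (fam i).Loc) (ζ : (fam i).Cut) (y y' : (fam i).Site),
    (fam i).cutIn ζ y → (fam i).suppIn J y' →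
      (fam i).l2loc 5 J ζ ≤ C * Real.exp (-(δ₀ * (fam i).dist y y')) * (fam i).cutSup ζ * (fam i).l2Norm J

/-- (1.114) for a family gives its sixth member. [cite: Balaban1984PropagatorsI, (1.114) p.36; bookkeeping] -/
theorem sixth_of_local114 {I' : Type} (fam : I' → B5.Setting) (h : B5.Local114Fam fam) : Local114SixthFam fam := by
  obtain ⟨δ₀, C, hδ, hC, h⟩ := h
  exact ⟨δ₀, C, hδ, hC, fun i J ζ y y' hζ hJ => h i 5 J ζ y y' hζ hJ⟩

/-- The weight η^d ≥ 0. [folklore] -/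
private theorem w_nonneg' (P : Params) (k : ℕ) : 0 ≤ (((P.L : ℝ) ^ k)⁻¹) ^ P.d := by positivity

/-- √(Σ_ν g_ν) ≤ Σ_ν D_ν when g_ν ≤ D_ν², D_ν ≥ 0. [folklore] -/
private theorem sqrt_sum_le' {ι : Type} [Fintype ι] (g D : ι → ℝ) (hD : ∀ i, 0 ≤ D i) (h : ∀ i, g i ≤ D i ^ 2) :
    Real.sqrt (∑ i, g i) ≤ ∑ i, D i := by
  have hS : 0 ≤ ∑ i, D i := Finset.sum_nonneg fun i _ => hD i
  have hle : ∑ i, g i ≤ (∑ i, D i) ^ 2 :=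
    calc ∑ i, g i ≤ ∑ i, D i ^ 2 := Finset.sum_le_sum fun i _ => h i
      _ = ∑ i, D i * D i := by simp [sq]
      _ ≤ ∑ i, D i * ∑ j, D j := Finset.sum_le_sum fun i _ =>
          mul_le_mul_of_nonneg_left (Finset.single_le_sum (f := D) (fun j _ => hD j) (Finset.mem_univ i)) (hD i)
      _ = (∑ i, D i) ^ 2 := by rw [sq, Finset.sum_mul]
  calc Real.sqrt (∑ i, g i) ≤ Real.sqrt ((∑ i, D i) ^ 2) := Real.sqrt_le_sqrt hle
    _ = ∑ i, D i := Real.sqrt_sq hS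

/-- A bound `C e^{−δ₀t} u s` is monotone in (C, −δ₀) for t, u, s ≥ 0, C′ ≥ 0. [folklore] -/
private theorem bound_mono'' {C C' δ δ₀ t u s : ℝ} (hC : C ≤ C') (hC' : 0 ≤ C') (hδ : δ ≤ δ₀) (ht : 0 ≤ t)
    (hu : 0 ≤ u) (hs : 0 ≤ s) :
    C * Real.exp (-(δ₀ * t)) * u * s ≤ C' * Real.exp (-(δ * t)) * u * s := by
  have he : Real.exp (-(δ₀ * t)) ≤ Real.exp (-(δ * t)) :=
    Real.exp_le_exp.mpr (neg_le_neg (mul_le_mul_of_nonneg_right hδ ht))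
  have h1 : C * Real.exp (-(δ₀ * t)) ≤ C' * Real.exp (-(δ * t)) :=
    (mul_le_mul_of_nonneg_right hC (Real.exp_pos _).le).trans (mul_le_mul_of_nonneg_left he hC')
  exact mul_le_mul_of_nonneg_right (mul_le_mul_of_nonneg_right h1 hu) hs

variable {a msq} in
/-- **‖ζG₀A‖ (diagonal member 0) ≤ Σ_μ ‖ζG₀^{(μ)} slot_{μ→μ}A‖ (scalar members 0 at the single-component sources)**.
[cite: Balaban1984PropagatorsI, (1.114) p.36] -/
theorem diag_l2loc0_le {P : Params} {k : ℕ} (A : Fin P.d → Site P 0 → ℝ) (ζ : Site P 0 → ℝ) :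
    (g0Diag P a msq k).l2loc 0 (.vec A) ζ ≤ ∑ μ, (g0Setting P a msq k μ).l2loc 0 (slot A μ μ) ζ := by
  show l2Fam P k (fun μ x => ζ x * dK0 P a msq k A μ x) ≤
    ∑ μ, l2Fam P k (fun ν x => ζ x * (G0 P a msq k μ *ᵥ slot A μ μ ν) x)
  unfold l2Fam
  refine sqrt_sum_le' _ _ (fun μ => Real.sqrt_nonneg _) fun μ => ?_
  rw [Real.sq_sqrt (Finset.sum_nonneg fun ν _ => Finset.sum_nonneg fun x _ => mul_nonneg (w_nonneg' P k) (sq_nonneg _))]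
  refine le_trans (le_of_eq ?_) (Finset.single_le_sum (f := fun ν => ∑ x, (((P.L : ℝ) ^ k)⁻¹) ^ P.d *
    (ζ x * (G0 P a msq k μ *ᵥ slot A μ μ ν) x) ^ 2)
    (fun ν _ => Finset.sum_nonneg fun x _ => mul_nonneg (w_nonneg' P k) (sq_nonneg _)) (Finset.mem_univ μ))
  have hs : slot A μ μ μ = A μ := by simp [slot]
  simp only [dK0, opK0, hs]

variable {a msq} in
/-- **‖ζ∇G₀A‖ (diagonal member 1) ≤ Σ_μ scalar members 1 at the single-component sources**. [cite: Balaban1984PropagatorsI, (1.114) p.36] -/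
theorem diag_l2loc1_le {P : Params} {k : ℕ} (A : Fin P.d → Site P 0 → ℝ) (ζ : Site P 0 → ℝ) :
    (g0Diag P a msq k).l2loc 1 (.vec A) ζ ≤ ∑ μ, (g0Setting P a msq k μ).l2loc 1 (slot A μ μ) ζ := by
  show l2Fam P k (fun (p : Fin P.d × Fin P.d) x => ζ x * dKD P a msq k A p x) ≤
    ∑ μ, l2Fam P k (fun (p : Fin P.d × Fin P.d) x => ζ x * ((dEta P k p.1 * G0 P a msq k μ) *ᵥ slot A μ μ p.2) x)
  unfold l2Fam
  rw [Fintype.sum_prod_type_right]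
  refine sqrt_sum_le' _ _ (fun μ => Real.sqrt_nonneg _) fun μ => ?_
  rw [Real.sq_sqrt (Finset.sum_nonneg fun p _ => Finset.sum_nonneg fun x _ => mul_nonneg (w_nonneg' P k) (sq_nonneg _)),
    Fintype.sum_prod_type (f := fun p : Fin P.d × Fin P.d =>
      ∑ x, (((P.L : ℝ) ^ k)⁻¹) ^ P.d * (ζ x * ((dEta P k p.1 * G0 P a msq k μ) *ᵥ slot A μ μ p.2) x) ^ 2)]
  refine Finset.sum_le_sum fun lam _ => ?_
  refine le_trans (le_of_eq ?_) (Finset.single_le_sum (f := fun ν => ∑ x, (((P.L : ℝ) ^ k)⁻¹) ^ P.d *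
    (ζ x * ((dEta P k lam * G0 P a msq k μ) *ᵥ slot A μ μ ν) x) ^ 2)
    (fun ν _ => Finset.sum_nonneg fun x _ => mul_nonneg (w_nonneg' P k) (sq_nonneg _)) (Finset.mem_univ μ))
  have hs : slot A μ μ μ = A μ := by simp [slot]
  simp only [dKD, opKD, hs]

variable {a msq} in
/-- **‖ζ∇∇G₀A‖ (diagonal member 4) ≤ Σ_μ scalar members 4 at the single-component sources**. [cite: Balaban1984PropagatorsI, (1.114) p.36] -/
theorem diag_l2loc4_le {P : Params} {k : ℕ} (A : Fin P.d → Site P 0 → ℝ) (ζ : Site P 0 → ℝ) :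
    (g0Diag P a msq k).l2loc 4 (.vec A) ζ ≤ ∑ μ, (g0Setting P a msq k μ).l2loc 4 (slot A μ μ) ζ := by
  show l2Fam P k (fun (p : (Fin P.d × Fin P.d) × Fin P.d) x => ζ x * dKD2 P a msq k A p x) ≤
    ∑ μ, l2Fam P k (fun (p : (Fin P.d × Fin P.d) × Fin P.d) x =>
      ζ x * ((dEta P k p.1.1 * dEta P k p.1.2 * G0 P a msq k μ) *ᵥ slot A μ μ p.2) x)
  unfold l2Fam
  rw [Fintype.sum_prod_type_right]
  refine sqrt_sum_le' _ _ (fun μ => Real.sqrt_nonneg _) fun μ => ?_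
  rw [Real.sq_sqrt (Finset.sum_nonneg fun p _ => Finset.sum_nonneg fun x _ => mul_nonneg (w_nonneg' P k) (sq_nonneg _)),
    Fintype.sum_prod_type (f := fun p : (Fin P.d × Fin P.d) × Fin P.d =>
      ∑ x, (((P.L : ℝ) ^ k)⁻¹) ^ P.d *
        (ζ x * ((dEta P k p.1.1 * dEta P k p.1.2 * G0 P a msq k μ) *ᵥ slot A μ μ p.2) x) ^ 2)]
  refine Finset.sum_le_sum fun q _ => ?_
  refine le_trans (le_of_eq ?_) (Finset.single_le_sum (f := fun ν => ∑ x, (((P.L : ℝ) ^ k)⁻¹) ^ P.d *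
    (ζ x * ((dEta P k q.1 * dEta P k q.2 * G0 P a msq k μ) *ᵥ slot A μ μ ν) x) ^ 2)
    (fun ν _ => Finset.sum_nonneg fun x _ => mul_nonneg (w_nonneg' P k) (sq_nonneg _)) (Finset.mem_univ μ))
  have hs : slot A μ μ μ = A μ := by simp [slot]
  simp only [dKD2, opKD2, hs]

variable {a msq} in
/-- **‖ζG₀∇*T‖ (diagonal member 2) ≤ Σ_μ ‖ζG₀^{(μ)}∇*row_μT‖ (scalar members 2 at the rows)**. [cite: Balaban1984PropagatorsI, (1.114) p.36] -/
theorem diag_l2loc2_le {P : Params} {k : ℕ} (T : Fin P.d → Fin P.d → Site P 0 → ℝ) (ζ : Site P 0 → ℝ) :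
    (g0Diag P a msq k).l2loc 2 (.ten T) ζ ≤ ∑ μ, (g0Setting P a msq k μ).l2loc 2 (B5G0DiagTorus.row T μ) ζ := by
  show l2Fam P k (fun μ x => ζ x * dDiv P a msq k T μ x) ≤
    ∑ μ, l2Fam P k (fun (_ : Unit) x => ζ x * opDiv P k (G0 P a msq k μ) (B5G0DiagTorus.row T μ) x)
  unfold l2Fam
  refine sqrt_sum_le' _ _ (fun μ => Real.sqrt_nonneg _) fun μ => ?_
  rw [Real.sq_sqrt (Finset.sum_nonneg fun _ _ => Finset.sum_nonneg fun x _ => mul_nonneg (w_nonneg' P k) (sq_nonneg _))]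
  simp only [Finset.univ_unique, Finset.sum_singleton]
  rfl

variable {a msq} in
/-- **‖ζ∇G₀∇*T‖ (diagonal member 3) ≤ Σ_μ scalar members 3 at the rows**. [cite: Balaban1984PropagatorsI, (1.114) p.36] -/
theorem diag_l2loc3_le {P : Params} {k : ℕ} (T : Fin P.d → Fin P.d → Site P 0 → ℝ) (ζ : Site P 0 → ℝ) :
    (g0Diag P a msq k).l2loc 3 (.ten T) ζ ≤ ∑ μ, (g0Setting P a msq k μ).l2loc 3 (B5G0DiagTorus.row T μ) ζ := by
  show l2Fam P k (fun (p : Fin P.d × Fin P.d) x => ζ x * dDD P a msq k T p x) ≤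
    ∑ μ, l2Fam P k (fun lam x => ζ x * opDD P k (G0 P a msq k μ) (B5G0DiagTorus.row T μ) lam x)
  unfold l2Fam
  rw [Fintype.sum_prod_type_right]
  refine sqrt_sum_le' _ _ (fun μ => Real.sqrt_nonneg _) fun μ => ?_
  rw [Real.sq_sqrt (Finset.sum_nonneg fun _ _ => Finset.sum_nonneg fun x _ => mul_nonneg (w_nonneg' P k) (sq_nonneg _))]
  rfl

/-- **(1.114) FOR THE DIAGONAL FAMILY from (1.114) for the scalar members (torus, μ) and the sixth member alone**
(P.d = d throughout): members 0, 1, 4 at a vector source are sums over μ of scalar members at single-component sources,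
members 2, 3 at a tensor source are sums over μ of scalar members at its rows; δ₀ ↦ min, C ↦ (d + 1)·max.
[cite: Balaban1984PropagatorsI, (1.114) p.36, (1.132) p.39] -/
theorem local114_diag_of_scalar {d : ℕ} (hPd : ∀ i, (Pf i).d = d) (hS : B5.Local114Fam (famScalar Pf a msq))
    (h5 : Local114SixthFam (famDiag Pf a msq)) : B5.Local114Fam (famDiag Pf a msq) := by
  obtain ⟨δ₀, C, hδ₀, hC, hS⟩ := hS
  obtain ⟨δ₅, C₅, hδ₅, hC₅, h5⟩ := h5
  have hM : 0 ≤ max C C₅ := le_max_of_le_left hC.le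
  refine ⟨min δ₀ δ₅, (d + 1) * max C C₅, lt_min hδ₀ hδ₅, by positivity, ?_⟩
  intro i n J ζ y y' hζ hJ
  change LocT (Pf i) at J
  change Site (Pf i) 0 → ℝ at ζ
  change Site (Pf i) (Pf i).K at y y'
  set E := Real.exp (-(min δ₀ δ₅ * T (Pf i) (Pf i).K y y')) with hE
  have ht : 0 ≤ T (Pf i) (Pf i).K y y' := T_nonneg (Pf i) (Pf i).K y y'
  have hE0 : 0 ≤ E := (Real.exp_pos _).le
  have hz : 0 ≤ supN (Pf i) ζ := supN_nonneg _ ζ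
  -- a scalar bound with (δ₀, C) relaxes to (min δ, max C); d of them sum to ≤ (d+1)·max C
  have relax : ∀ {q s : ℝ}, 0 ≤ s → q ≤ C * Real.exp (-(δ₀ * T (Pf i) (Pf i).K y y')) * supN (Pf i) ζ * s →
      q ≤ max C C₅ * E * supN (Pf i) ζ * s := fun hs hq =>
    hq.trans (bound_mono'' (le_max_left _ _) hM (min_le_left δ₀ δ₅) ht hz hs)
  have sum_le : ∀ {s : ℝ}, 0 ≤ s → ∑ _μ : Fin (Pf i).d, max C C₅ * E * supN (Pf i) ζ * s ≤
      (d + 1) * max C C₅ * E * supN (Pf i) ζ * s := by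
    intro s hs
    rw [Finset.sum_const, Finset.card_univ, Fintype.card_fin, nsmul_eq_mul]
    have hdd : ((Pf i).d : ℝ) = d := by exact_mod_cast hPd i
    rw [hdd]
    have h0 : 0 ≤ max C C₅ * E * supN (Pf i) ζ * s := mul_nonneg (mul_nonneg (mul_nonneg hM hE0) hz) hs
    nlinarith
  have zero_le : ∀ {s : ℝ}, 0 ≤ s → (0 : ℝ) ≤ (d + 1) * max C C₅ * E * supN (Pf i) ζ * s := fun hs =>
    mul_nonneg (mul_nonneg (mul_nonneg (by positivity) hE0) hz) hs
  cases J with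
  | vec A =>
    have hA : ∀ μ x, A μ x ≠ 0 → inCube (Pf i) (Pf i).K x y' := hJ
    have hnA : 0 ≤ l2Fam (Pf i) (Pf i).K A := l2Fam_nonneg (P := Pf i) (Pf i).K A
    -- scalar member μ at the single-component source slot A μ μ
    have hsl : ∀ (m : Fin 6) (μ : Fin (Pf i).d), (g0Setting (Pf i) a msq (Pf i).K μ).l2loc m (slot A μ μ) ζ ≤
        max C C₅ * E * supN (Pf i) ζ * l2Fam (Pf i) (Pf i).K A := by
      intro m μ
      have h : (g0Setting (Pf i) a msq (Pf i).K μ).l2loc m (slot A μ μ) ζ ≤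
          C * Real.exp (-(δ₀ * T (Pf i) (Pf i).K y y')) * supN (Pf i) ζ * l2NormV (Pf i) (Pf i).K (slot A μ μ) :=
        hS ⟨i, μ⟩ m (slot A μ μ) ζ y y' hζ (suppIn_slot hA μ μ)
      rw [l2NormV_eq_l2Fam] at h
      refine (relax (l2Fam_nonneg (P := Pf i) (Pf i).K _) h).trans ?_
      exact mul_le_mul_of_nonneg_left (l2Fam_slot_le A μ μ) (mul_nonneg (mul_nonneg hM hE0) hz)
    show l2loc3 (Pf i) a msq (Pf i).K n (LocT.vec A) ζ ≤ (d + 1) * max C C₅ * E * supN (Pf i) ζ * l2Fam (Pf i) (Pf i).K A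
    fin_cases n
    · exact (diag_l2loc0_le A ζ).trans ((Finset.sum_le_sum fun μ _ => hsl 0 μ).trans (sum_le hnA))
    · exact (diag_l2loc1_le A ζ).trans ((Finset.sum_le_sum fun μ _ => hsl 1 μ).trans (sum_le hnA))
    · exact zero_le hnA
    · exact zero_le hnA
    · exact (diag_l2loc4_le A ζ).trans ((Finset.sum_le_sum fun μ _ => hsl 4 μ).trans (sum_le hnA))
    · exact zero_le hnA
  | ten T' =>
    have hT : ∀ ν μ x, T' ν μ x ≠ 0 → inCube (Pf i) (Pf i).K x y' := hJ
    have hnT : 0 ≤ l2Fam (Pf i) (Pf i).K (fun p : Fin (Pf i).d × Fin (Pf i).d => T' p.1 p.2) :=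
      l2Fam_nonneg (P := Pf i) (Pf i).K _
    have hrow : ∀ (m : Fin 6) (μ : Fin (Pf i).d), (g0Setting (Pf i) a msq (Pf i).K μ).l2loc m (B5G0DiagTorus.row T' μ) ζ ≤
        max C C₅ * E * supN (Pf i) ζ * l2Fam (Pf i) (Pf i).K (fun p : Fin (Pf i).d × Fin (Pf i).d => T' p.1 p.2) := by
      intro m μ
      have h : (g0Setting (Pf i) a msq (Pf i).K μ).l2loc m (B5G0DiagTorus.row T' μ) ζ ≤
          C * Real.exp (-(δ₀ * T (Pf i) (Pf i).K y y')) * supN (Pf i) ζ *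
            l2NormV (Pf i) (Pf i).K (B5G0DiagTorus.row T' μ) :=
        hS ⟨i, μ⟩ m (B5G0DiagTorus.row T' μ) ζ y y' hζ (suppIn_row hT μ)
      rw [l2NormV_eq_l2Fam] at h
      refine (relax (l2Fam_nonneg (P := Pf i) (Pf i).K _) h).trans ?_
      exact mul_le_mul_of_nonneg_left (l2Fam_row_le T' μ) (mul_nonneg (mul_nonneg hM hE0) hz)
    show l2loc3 (Pf i) a msq (Pf i).K n (LocT.ten T') ζ ≤ (d + 1) * max C C₅ * E * supN (Pf i) ζ *
      l2Fam (Pf i) (Pf i).K (fun p : Fin (Pf i).d × Fin (Pf i).d => T' p.1 p.2)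
    fin_cases n
    · exact zero_le hnT
    · exact zero_le hnT
    · exact (diag_l2loc2_le T' ζ).trans ((Finset.sum_le_sum fun μ _ => hrow 2 μ).trans (sum_le hnT))
    · exact (diag_l2loc3_le T' ζ).trans ((Finset.sum_le_sum fun μ _ => hrow 3 μ).trans (sum_le hnT))
    · exact zero_le hnT
    · exact zero_le hnT
  | ten2 T' =>
    have hnT : 0 ≤ l2Fam (Pf i) (Pf i).K (fun p : (Fin (Pf i).d × Fin (Pf i).d) × Fin (Pf i).d => T' p.1 p.2) :=
      l2Fam_nonneg (P := Pf i) (Pf i).K _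
    show l2loc3 (Pf i) a msq (Pf i).K n (LocT.ten2 T') ζ ≤ (d + 1) * max C C₅ * E * supN (Pf i) ζ *
      l2Fam (Pf i) (Pf i).K (fun p : (Fin (Pf i).d × Fin (Pf i).d) × Fin (Pf i).d => T' p.1 p.2)
    fin_cases n
    · exact zero_le hnT
    · exact zero_le hnT
    · exact zero_le hnT
    · exact zero_le hnT
    · exact zero_le hnT
    · have h : l2loc3 (Pf i) a msq (Pf i).K 5 (LocT.ten2 T') ζ ≤ C₅ * Real.exp (-(δ₅ * T (Pf i) (Pf i).K y y')) *
          supN (Pf i) ζ * l2Fam (Pf i) (Pf i).K (fun p : (Fin (Pf i).d × Fin (Pf i).d) × Fin (Pf i).d => T' p.1 p.2) :=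
        h5 i (LocT.ten2 T') ζ y y' hζ hJ
      refine h.trans ((bound_mono'' (le_max_right _ _) hM (min_le_right δ₀ δ₅) ht hz hnT).trans ?_)
      have h0 : 0 ≤ max C C₅ * E * supN (Pf i) ζ *
          l2Fam (Pf i) (Pf i).K (fun p : (Fin (Pf i).d × Fin (Pf i).d) × Fin (Pf i).d => T' p.1 p.2) :=
        mul_nonneg (mul_nonneg (mul_nonneg hM hE0) hz) hnT
      nlinarith

end Sixth

/-- **(1.114) for the diagonal family of record from (1.114) for the scalar family of record and the sixth member** —
so the random-walk step (census (vi)) may be run on the scalar settings plus the one 2-tensor member.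
[cite: Balaban1984PropagatorsI, (1.114) p.36, (1.132) p.39] -/
theorem local114DiagTop_of_scalar (d L : ℕ) (a msq : ℝ) (hS : B5.Local114Fam (famG0Top d L a msq))
    (h5 : Local114SixthFam (famDiagTop d L a msq)) : B5.Local114Fam (famDiagTop d L a msq) := by
  have hS' : B5.Local114Fam (famScalar (fun i : B5ResidualGpTorusHolds.TopIdx d L => i.P) a msq) :=
    local114_reindex _ (fun j : (Σ i : B5ResidualGpTorusHolds.TopIdx d L, Fin i.P.d) =>
      (⟨j.1.P, j.1.hPd, j.1.hPL, j.1.hK, j.2⟩ : G0TopIdx d L)) hS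
  exact local114_diag_of_scalar _ a msq (fun i => i.hPd) hS' h5

/-- **PROPOSITION 1.2 FOR THE DIAGONAL G₀ FROM (1.114) FOR THE SCALAR FAMILY + THE SIXTH MEMBER** (m² = 0).
[cite: Balaban1984PropagatorsI, Prop. 1.2 (1.110)–(1.114) pp.35–36, (1.132)–(1.134) p.39] -/
theorem prop12DiagTop_of_scalar114 (d L : ℕ) (hd : 1 ≤ d) (hL : Odd L ∧ 1 < L) {a : ℝ} (ha : 0 < a)
    (h114G0 : B5.Local114Fam (famG0Top d L a 0)) (h5 : Local114SixthFam (famDiagTop d L a 0)) :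
    B5.Prop12Printed (famDiagTop d L a 0) :=
  prop12DiagTop_of_local114 d L hd hL ha (local114DiagTop_of_scalar d L a 0 h114G0 h5)

end B5Prop12G0DiagTorus

end

end Literature.MathematicalPhysics.QuantumFieldTheory.Balaban1983to89
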